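import Summits.ResolutionOfSingularities.ResolutionOfSingularities.Theorems.FrobeniusLadderFRationalResolutionResolutionLocal
import Summits.ResolutionOfSingularities.ResolutionOfSingularities.Theorems.FrobeniusLadderFRationalResolutionTowerStep
import Literature.AlgebraicGeometry.Resolution.CanonicalResolutionProofs
import Literature.AlgebraicGeometry.Resolution.RegularLocusDense
import HarnessLib

/-!
# Crux `FrobeniusLadder.FRationalResolution` (stmt-ResolutionOfSingularities-15317), line `redirect`,
# stub `stub_diagonalizableQuotientResolution` — ISOLATED singularities: local resolutions glue,
# in every dimension and over every field

Companion of `FrobeniusLadderFRationalResolutionDiagQuotientNormal.lean` /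
`FrobeniusLadderFRationalResolutionDiagQuotientSurface.lean`. The surface gluing
`hasResolution_fRational_surface_of_local` (c5 lead) and its normal-surface form use the dimension
only to know that the singular locus is FINITE; this file records the dimension-free statement, which
is the assembly step for ISOLATED diagonalizable quotient singularities in any dimension (no
compatibility of étale charts is needed there — only one local resolution per singular point, an
isomorphism over the regular locus):

* `hasResolution_of_finite_singularLocus_of_local` — `X` integral, locally of finite type over a
  field, `X ∖ Reg X` finite, and every singular point `s` has an open `V ∋ s` with no other singular
  point and a proper `ρ : Y → V`, `Y` regular, an isomorphism over `V ∩ Reg X` with dense preimage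
  ⇒ `Scheme.HasResolution X` (`Reg X` open — fields are J-2 — and dense; glue one point at a time,
  `stub_hasResolution_of_local_resolutions`).

Honest label: gluing only; the local resolutions (for the stub: linearisation of the regular graded
chart at a fixed point, Kato's one-chart toric resolution by a monomial `𝔪`-primary blow-up, descent
of that centre along the étale chart) are the open part. No definitions, no named facts, no sorry.
[folklore; cite: Matsumura1987, §30 Cor. to Thm. 30.5 (Reg open over a field)]
-/

noncomputable section

-- single-problem summit: the doubled namespace component is forced
set_option linter.dupNamespace false

open CategoryTheory AlgebraicGeometry TopologicalSpace
open Literature.AlgebraicGeometry.Resolution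

namespace Summit.ResolutionOfSingularities.ResolutionOfSingularities.Theorems.FRationalResolution.IsolatedGlue

/-- **Local resolutions at finitely many singular points glue to a resolution, in every
dimension and over every field.** For `X` integral and locally of finite type over a field `k`
whose singular locus `X ∖ Reg X` is FINITE: if every singular point `s` has an open `V ∋ s`
containing no other singular point and a proper `ρ : Y → V` with `Y` regular which is an
isomorphism over `V ∩ Reg X` with dense preimage, then `X` has a resolution of singularities
(`Reg X` is open — fields are J-2, `isOpen_regularLocus_of_locallyOfFiniteType_field` — and dense —
`Scheme.dense_regularLocus`; the local resolutions are glued one point at a time by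
`stub_hasResolution_of_local_resolutions`). Dimension-free content of
`hasResolution_fRational_surface_of_local`. [folklore] -/
theorem hasResolution_of_finite_singularLocus_of_local (k : Type) [Field k] (X : Scheme.{0})
    [IsIntegral X] (f : X ⟶ Spec (.of k)) [LocallyOfFiniteType f]
    (hfin : (Scheme.regularLocus X)ᶜ.Finite)
    (hloc : ∀ s : X, s ∉ Scheme.regularLocus X → ∃ (V : X.Opens), s ∈ V ∧
      (∀ t : X, t ∉ Scheme.regularLocus X → t ∈ V → t = s) ∧
      ∃ (Y : Scheme.{0}) (ρ : Y ⟶ V), IsProper ρ ∧ Scheme.IsRegular Y ∧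
        IsIso (ρ ∣_ (V.ι ⁻¹ᵁ ⟨Scheme.regularLocus X, isOpen_regularLocus_of_locallyOfFiniteType_field f⟩)) ∧
        Dense ((ρ ⁻¹ᵁ (V.ι ⁻¹ᵁ ⟨Scheme.regularLocus X,
          isOpen_regularLocus_of_locallyOfFiniteType_field f⟩) : Y.Opens) : Set Y)) :
    Scheme.HasResolution X := by
  classical
  -- the open regular locus `U`, a regular scheme
  set U : X.Opens := ⟨Scheme.regularLocus X, isOpen_regularLocus_of_locallyOfFiniteType_field f⟩
    with hU
  have hmemU : ∀ x : X, x ∈ U ↔ IsRegularLocalRing (X.presheaf.stalk x) := fun x => Iff.rfl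
  have hUreg : Scheme.IsRegular (U : Scheme.{0}) :=
    isRegular_opens_of_stalk U fun x hx => (hmemU x).mp hx
  -- the finitely many singular points
  set S : Finset X := hfin.toFinset with hS
  have hmemS : ∀ x : X, x ∈ S ↔ x ∉ Scheme.regularLocus X := fun x => by
    rw [hS, Set.Finite.mem_toFinset]; rfl
  have hcov : ∀ x : X, x ∈ U ∨ x ∈ S := fun x => by
    by_cases hx : x ∈ Scheme.regularLocus X
    · exact Or.inl hx
    · exact Or.inr ((hmemS x).mpr hx)
  have hloc' : ∀ s ∈ S, ∃ (V : X.Opens), s ∈ V ∧ (∀ t ∈ S, t ∈ V → t = s) ∧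
      ∃ (Y : Scheme.{0}) (ρ : Y ⟶ V), IsProper ρ ∧ Scheme.IsRegular Y ∧
        IsIso (ρ ∣_ (V.ι ⁻¹ᵁ U)) ∧ Dense ((ρ ⁻¹ᵁ (V.ι ⁻¹ᵁ U) : Y.Opens) : Set Y) := by
    intro s hs
    obtain ⟨V, hsV, hVS, Y, ρ, hρ, hY, hiso, hd⟩ := hloc s ((hmemS s).mp hs)
    exact ⟨V, hsV, fun t ht htV => hVS t ((hmemS t).mp ht) htV, Y, ρ, hρ, hY, hiso, hd⟩
  obtain ⟨X', π, hπ, hX'reg, hiso, hd⟩ :=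
    stub_hasResolution_of_local_resolutions X U hUreg S hcov hloc'
  -- `U = Reg X` is dense (`X` is reduced)
  have hUd : Dense (U : Set X) := Scheme.dense_regularLocus X
  haveI := hπ
  exact ⟨X', π, ⟨inferInstance, ⟨U, hUd, hd, hiso⟩, hX'reg⟩⟩

/-- **Corollary — isolated singularities, singular locus given as a finite set of points with
local resolutions**: the same with the finiteness phrased by a `Finset` containing every singular
point (the form in which a case analysis over finitely many explicit singular points is fed).
[folklore] -/
theorem hasResolution_of_finset_singularLocus_of_local (k : Type) [Field k] (X : Scheme.{0})
    [IsIntegral X] (f : X ⟶ Spec (.of k)) [LocallyOfFiniteType f] (S : Finset X)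
    (hS : ∀ x : X, x ∉ Scheme.regularLocus X → x ∈ S)
    (hloc : ∀ s : X, s ∉ Scheme.regularLocus X → ∃ (V : X.Opens), s ∈ V ∧
      (∀ t : X, t ∉ Scheme.regularLocus X → t ∈ V → t = s) ∧
      ∃ (Y : Scheme.{0}) (ρ : Y ⟶ V), IsProper ρ ∧ Scheme.IsRegular Y ∧
        IsIso (ρ ∣_ (V.ι ⁻¹ᵁ ⟨Scheme.regularLocus X, isOpen_regularLocus_of_locallyOfFiniteType_field f⟩)) ∧
        Dense ((ρ ⁻¹ᵁ (V.ι ⁻¹ᵁ ⟨Scheme.regularLocus X,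
          isOpen_regularLocus_of_locallyOfFiniteType_field f⟩) : Y.Opens) : Set Y)) :
    Scheme.HasResolution X :=
  hasResolution_of_finite_singularLocus_of_local k X f
    ((S.finite_toSet).subset fun x hx => hS x hx) hloc

end Summit.ResolutionOfSingularities.ResolutionOfSingularities.Theorems.FRationalResolution.IsolatedGlue

end
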